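import Literature.MathematicalPhysics.QuantumFieldTheory.Balaban1983to89.Beta.RemainderHasMajGreenPrimeTowerDecayCosh

/-!
# T. Bałaban, *Propagators for lattice gauge theories in a background field*, Commun. Math. Phys. **99** (1985) 389–434
# [Balaban1985BackgroundPropagators] Thm 3.1 (3.42) for `G′_k(U)` AS THE `hG`-SHAPED `HasMaj` OF ROW (D4) WITH A CONSTANT FREE OF THE HEIGHT:
# on the diagonal `η⁻¹ = L^{n+1}`, `c₀(L^{n+1})^d = c₁`, at the rate `a⋆` of `rate_explicit`, `HasMaj S_m S_m (G′_k(U)↾ℝ) (B⋆·e^{−κ′d_∞})` with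
# `B⋆ = (1 + p₂C_E√c₁)·2e^{1∕2}·Σ_{l<k′}2^{l+1} + √(3^d∕c₁·2^{k′})·√(2e^{1∕2}·K_d(1∕√(4d+1) − 2κ′))·C_E·√c₁` — NO `n`, NO `L`, NO `m`, NO `η`:
# print's *«B₀, δ₀ dependent on d and L only»* in the (190) sup-size currency, modulo (T), (D-P)_k, (D-E)_k

CITATION HEADER (lean-in-tree rule 2026-08-18).  Sources: [Balaban1985BackgroundPropagators] (B9; held
`paper:balaban1985-cmp99-background-propagators`, journal page = PDF page + 388): p. 397 Thm 3.1 *«There exist positive constants M₁, δ₀, a₀, B₀ dependent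
on d and L only … such that … the operator G′(U) … satisfies |(G′(U)λ)(x)| … ≦ B₀e^{−δ₀d(y,y′)}|λ| for x ∈ Δ(y), y ∈ Λ_j, supp λ ⊂ Δ(y′)»* (3.42), (3.39)
p. 397, (3.49) p. 399 (unit blocks), (3.19) p. 393, (3.24)–(3.25) p. 394; [Balaban1984PropagatorsI] (B5) p. 36 (the rate of the exponential weight);
[Balaban1985Variational] (B11) (180) p. 306, (190) p. 308; [Balaban1984PropagatorsII] (B6) (2.51)–(2.52) p. 232.

WHY THIS FILE (audit cell `pub-balaban`, BINDER row (D4), OWNER lineage `b2b-balaban-beta-an4`, gen 108; «Y3d»).  `Beta.RemainderHasMajGreenPrimeTowerDecayCosh`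
(Y3c) puts the NE9 OWNER's tower `cosh` assembly `norm_GpOfUk_apply_le_decay_cosh` into row (D4)'s `hG`-shaped socket at height `k = n+1` for ANY rate `a`,
with the height-dependent constant `B_k(a)`.  What carries content for NODE D of row (D4) is the UNIFORMITY IN THE HEIGHT (census `BETA/REMAINDER-BETA.md`
§10.98∕§10.99: «the k-uniformity is all that carries content on NODE D»).  The NE9 OWNER's `B9Eq342GreenPrimeTowerSupBoundDecayCosh.
norm_GpOfUk_apply_le_rowSum_heightFree` shows, for the ROW SUM, that at the rate `a⋆ = (4d(L^{n+1})² + 1)^{−1∕2}` of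
`B9Eq342GreenPrimeSupBoundDecayCosh.rate_explicit` every height-dependent letter has a height-free majorant (`λ ≥ 1∕2`, `a⋆L^{n+1} ≥ 1∕√(4d+1)`,
`a⋆(L^{n+1} − 1) ≤ 1∕2`).  THIS FILE does the same bookkeeping for the per-block DECAY form and reads it through the socket:
* **`hasMaj_GpOfUk_of_cosh_letters_heightFree_sup`** — on the diagonal `η⁻¹ = L^{n+1}`, `c₀(L^{n+1})^d = c₁`, for `1 ≤ d ≤ k′`, `0 ≤ κ′ ≤ κ`,
  `2κ′ < 1∕√(4d+1)`: `HasMaj S_m S_m ((e∘G′_k(U)∘e⁻¹)↾ℝ) (B⋆·e^{−κ′·d_∞})` with `B⋆` as in the title — a function of `(d, p₂, C_E, κ′, k′, c₁)` ALONE;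
* **`hasMaj_GpOfUk_of_cosh_letters_heightFree`** — the same in the geometry's distance with the CLM packaging (the `hG` binder of
  `Beta.RemainderChartOriginDerivative.ineq190_fderiv_chartH179_zero_of_letters` token for token, `δ₀ = κ′∕d`);
* **`hasMaj_GpOfUk_of_cosh_letters_heightFree_unitary`** — on the chain's class (unitary `U`, `*`-trace, compatible fibre norm) (T) holds with equality:
  letters (D-P)_k + (D-E)_k ONLY, constant `B⋆`.
Mechanism: Y3c at `a := a⋆` composed with `B11SectG.HasMaj.mono` and the comparison `B_k(a⋆) ≤ B⋆` (`λ^{−j} ≤ 2^j`, `e^{a⋆(L^{n+1}−1)} ≤ e^{1∕2}`,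
`K_d(a⋆L^{n+1} − 2κ′) ≤ K_d(1∕√(4d+1) − 2κ′)` by antitonicity) — the NE9 OWNER's height-free arithmetic, re-run on the decay form.

HONEST SCOPE.  [folklore] bookkeeping; NO estimate of [5] is proved here; the operator is [5] Thm 3.1's SITE operator `G′_k(U)`, NOT Thm 3.3's BOND operator
`Δ_a⁻¹` of NODE D (Sect. C's random walk — the `Gaps/D4WalkBlock*` road); the remaining letters (T) `hR`∕`hS` (inhabited on the unitary class by Y3c's
`…_unitary`), (D-P)_k `hP` (NE9's staged `…TowerSupBoundDecayPenalty` makes `p₂ = |a′|∕√c₁` height-free), (D-E)_k `hdec` (`C_E`, `κ` — the NE9 chain's `L²`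
big-block decay, height-free on its window) are HYPOTHESES, and the height-freeness of `B⋆` is ONLY AS GOOD AS THEIRS.  Nothing identifies Bałaban's step
objects (NODE O).  Row (D4) class UNCHANGED (instance 0∕1; D4 DISCHARGE NO DATE); NOT B12 Thm 2, NOT BetaPertH, NOT continuum, NOT Clay.  HONEST DEPENDENCY
(cell line): continuum YM on T⁴ ⇐ BetaPertH ∧ nine spine estimates (0/9 proved); BetaPertH ⇐ (D1) ∧ (D4) ∧ CAP+tail; G-an2-4 gates asym, D1 and NE2/3/4.
NEW file importing `Beta.RemainderHasMajGreenPrimeTowerDecayCosh` only; nothing modified; 0 `def`; standard axioms; no `sorry`.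
-/

noncomputable section

open scoped BigOperators InnerProductSpace

namespace Literature.MathematicalPhysics.QuantumFieldTheory.Balaban1983to89.Beta.RemainderHasMajGreenPrimeTowerDecayCoshHeightFree

open B11SectG B11SupSize190
open B4Sect5Torus (TSite tdist)
open B4Sect5Proof (latticeConst latticeConst_nonneg)
open B5TorusCover (UT)
open B9Thm34Ext (toB6)
open B9Thm37GlueTorus (torusGeom)
open B9SectCLatticeCarrier (Bond)
open B9Eq311L2Pairing (WL2)
open B9Eq319QprimeTorus (fineP blockCoord)
open B9Eq315QTower (towerP towerP_apply)
open B9Eq316TowerFlatIsOneStep (towerP_eq_fineP_pow siteCast)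
open B9Eq310HessianOperator (adTransportW)
open B11Eq103H1Complex (SiteL2K covLaplaceSiteK)
open B9Eq324DeltaPrimeATower (laplacePrimeAk GpOfUk)
open B9Eq342GreenPrimeSupBound (norm_adTransportW_eq norm_adTransportW_inv_eq)
open B9Eq342GreenPrimeSupBoundDecayCosh (rate_explicit)
open Beta.RemainderHasMajGreenPrimeTowerDecayCosh (hasMaj_GpOfUk_of_cosh_letters_sup hasMaj_GpOfUk_of_cosh_letters)

/-- `K_d` is antitone in the rate: `0 < a ≤ b ⟹ K_d(b) ≤ K_d(a)` (private twin of the NE9 OWNER's `latticeConst_anti` ∕ the cell's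
`B3Op116ScaleChains.latticeConst_antitone`). [folklore] -/
private theorem latticeConst_anti {d : ℕ} (hd : 1 ≤ d) {a b : ℝ} (ha : 0 < a) (hab : a ≤ b) : latticeConst d b ≤ latticeConst d a := by
  unfold latticeConst
  have hdp : (0 : ℝ) < d := by exact_mod_cast hd
  have hea : Real.exp (-(b / d)) ≤ Real.exp (-(a / d)) :=
    Real.exp_le_exp.mpr (neg_le_neg (div_le_div_of_nonneg_right hab hdp.le))
  have hpa : 0 < 1 - Real.exp (-(a / d)) := by
    have : Real.exp (-(a / d)) < 1 := Real.exp_lt_one_iff.mpr (by have := div_pos ha hdp; linarith)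
    linarith
  have hinv : (1 - Real.exp (-(b / d)))⁻¹ ≤ (1 - Real.exp (-(a / d)))⁻¹ := inv_anti₀ hpa (by linarith)
  exact pow_le_pow_left₀ (mul_nonneg (by norm_num) (inv_nonneg.mpr (by linarith))) (mul_le_mul_of_nonneg_left hinv (by norm_num)) d

/-- **THE HEIGHT-FREE COMPARISON OF THE CONSTANT**: on the diagonal `η⁻¹ = N = L^{n+1} ≥ 1` and at `a⋆ = (4dN² + 1)^{−1∕2}`:
`0 ≤ a⋆`, `0 < λ`, `2κ′ < a⋆N` and `B_k(a⋆) ≤ B⋆` (`λ^{−j} ≤ 2^j`, `e^{a⋆(N−1)} ≤ e^{1∕2}`, `K_d(a⋆N − 2κ′) ≤ K_d(1∕√(4d+1) − 2κ′)`). [folklore]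
[cite: Balaban1984PropagatorsI, p.36] [cite: Balaban1985BackgroundPropagators, Thm 3.1 p.397] -/
theorem const_heightFree {d : ℕ} (hd : 1 ≤ d) {N η : ℝ} (hN1 : 1 ≤ N) (hηN : η⁻¹ = N) {p₂ CE κ' μ c₁ : ℝ} (hp₂ : 0 ≤ p₂) (hCE : 0 ≤ CE)
    (hc₁ : 0 < c₁) (h2κ : 2 * κ' < Real.sqrt (1 / (4 * d + 1))) (k : ℕ) :
    0 ≤ Real.sqrt (1 / (4 * d * N ^ 2 + 1)) ∧ 0 < 1 - 2 * d * (η⁻¹) ^ 2 * (Real.cosh (Real.sqrt (1 / (4 * d * N ^ 2 + 1))) - 1) ∧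
      2 * κ' < Real.sqrt (1 / (4 * d * N ^ 2 + 1)) * N ∧
      (1 + p₂ * CE * Real.sqrt μ) * (Real.exp (Real.sqrt (1 / (4 * d * N ^ 2 + 1)) * (N - 1)) * 2) *
            (∑ l ∈ Finset.range k, ((1 - 2 * d * (η⁻¹) ^ 2 * (Real.cosh (Real.sqrt (1 / (4 * d * N ^ 2 + 1))) - 1)) ^ (l + 1))⁻¹) +
          Real.sqrt (3 ^ d / c₁ * ((1 - 2 * d * (η⁻¹) ^ 2 * (Real.cosh (Real.sqrt (1 / (4 * d * N ^ 2 + 1))) - 1)) ^ k)⁻¹) *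
            Real.sqrt ((Real.exp (Real.sqrt (1 / (4 * d * N ^ 2 + 1)) * (N - 1)) * 2) *
              latticeConst d (Real.sqrt (1 / (4 * d * N ^ 2 + 1)) * N - 2 * κ')) * CE * Real.sqrt μ ≤
        (1 + p₂ * CE * Real.sqrt μ) * (Real.exp (1 / 2) * 2) * (∑ l ∈ Finset.range k, (2 : ℝ) ^ (l + 1)) +
          Real.sqrt (3 ^ d / c₁ * 2 ^ k) * Real.sqrt ((Real.exp (1 / 2) * 2) * latticeConst d (Real.sqrt (1 / (4 * d + 1)) - 2 * κ')) *
            CE * Real.sqrt μ := by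
  have hN0 : 0 < N := lt_of_lt_of_le one_pos hN1
  obtain ⟨ha0, _, hlam2, hκN⟩ := rate_explicit (d := d) N 1 one_pos hN1
  set a : ℝ := Real.sqrt (1 / (4 * d * N ^ 2 + 1))
  have ha : 0 ≤ a := ha0.le
  have hlam' : 1 / 2 ≤ 1 - 2 * d * (η⁻¹) ^ 2 * (Real.cosh a - 1) := by rw [hηN]; simpa using hlam2
  have hlam : 0 < 1 - 2 * d * (η⁻¹) ^ 2 * (Real.cosh a - 1) := lt_of_lt_of_le (by norm_num) hlam'
  have hκN' : Real.sqrt (1 / (4 * d + 1)) ≤ a * N := by simpa using hκN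
  have hκ₁ : 2 * κ' < a * N := lt_of_lt_of_le h2κ hκN'
  have hq : (0 : ℝ) < 1 / (4 * d * N ^ 2 + 1) := by positivity
  have haN : a * N ≤ 1 / 2 := by
    have e : a * N = Real.sqrt (1 / (4 * d * N ^ 2 + 1) * N ^ 2) := by
      rw [Real.sqrt_mul hq.le, Real.sqrt_sq hN0.le]
    rw [e, show (1 / 2 : ℝ) = Real.sqrt ((1 / 2) ^ 2) by rw [Real.sqrt_sq (by norm_num)]]
    refine Real.sqrt_le_sqrt ?_
    have hd' : (1 : ℝ) ≤ d := by exact_mod_cast hd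
    rw [div_mul_eq_mul_div, one_mul, div_le_iff₀ (by positivity)]
    nlinarith [sq_nonneg N]
  have haN1 : a * (N - 1) ≤ 1 / 2 := by nlinarith
  refine ⟨ha, hlam, hκ₁, ?_⟩
  set lam : ℝ := 1 - 2 * d * (η⁻¹) ^ 2 * (Real.cosh a - 1)
  have hpow : ∀ j : ℕ, (lam ^ j)⁻¹ ≤ (2 : ℝ) ^ j := fun j => by
    have h1 : ((1 / 2 : ℝ) ^ j) ≤ lam ^ j := pow_le_pow_left₀ (by norm_num) hlam' j
    calc (lam ^ j)⁻¹ ≤ ((1 / 2 : ℝ) ^ j)⁻¹ := inv_anti₀ (pow_pos (by norm_num) j) h1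
      _ = 2 ^ j := by rw [one_div, inv_pow, inv_inv]
  have hM : Real.exp (a * (N - 1)) * 2 ≤ Real.exp (1 / 2) * 2 :=
    mul_le_mul_of_nonneg_right (Real.exp_le_exp.2 haN1) zero_le_two
  have hKa : latticeConst d (a * N - 2 * κ') ≤ latticeConst d (Real.sqrt (1 / (4 * d + 1)) - 2 * κ') :=
    latticeConst_anti hd (by linarith) (by linarith)
  have hKa0 : 0 ≤ latticeConst d (a * N - 2 * κ') := latticeConst_nonneg d (by linarith)
  have hsum : ∑ l ∈ Finset.range k, (lam ^ (l + 1))⁻¹ ≤ ∑ l ∈ Finset.range k, (2 : ℝ) ^ (l + 1) :=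
    Finset.sum_le_sum fun l _ => hpow (l + 1)
  have hsum0 : 0 ≤ ∑ l ∈ Finset.range k, (lam ^ (l + 1))⁻¹ := Finset.sum_nonneg fun l _ => inv_nonneg.2 (pow_nonneg hlam.le _)
  have hB₁ : (1 + p₂ * CE * Real.sqrt μ) * (Real.exp (a * (N - 1)) * 2) * (∑ l ∈ Finset.range k, (lam ^ (l + 1))⁻¹) ≤
      (1 + p₂ * CE * Real.sqrt μ) * (Real.exp (1 / 2) * 2) * (∑ l ∈ Finset.range k, (2 : ℝ) ^ (l + 1)) := by
    have h0 : 0 ≤ 1 + p₂ * CE * Real.sqrt μ := by positivity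
    exact mul_le_mul (mul_le_mul_of_nonneg_left hM h0) hsum hsum0 (mul_nonneg h0 (by positivity))
  have hC₃ : Real.sqrt (3 ^ d / c₁ * (lam ^ k)⁻¹) ≤ Real.sqrt (3 ^ d / c₁ * 2 ^ k) :=
    Real.sqrt_le_sqrt (mul_le_mul_of_nonneg_left (hpow k) (by positivity))
  have hMK : Real.sqrt ((Real.exp (a * (N - 1)) * 2) * latticeConst d (a * N - 2 * κ')) ≤
      Real.sqrt ((Real.exp (1 / 2) * 2) * latticeConst d (Real.sqrt (1 / (4 * d + 1)) - 2 * κ')) :=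
    Real.sqrt_le_sqrt (mul_le_mul hM hKa hKa0 (by positivity))
  have hB₂ : Real.sqrt (3 ^ d / c₁ * (lam ^ k)⁻¹) * Real.sqrt ((Real.exp (a * (N - 1)) * 2) * latticeConst d (a * N - 2 * κ')) * CE *
        Real.sqrt μ ≤
      Real.sqrt (3 ^ d / c₁ * 2 ^ k) * Real.sqrt ((Real.exp (1 / 2) * 2) * latticeConst d (Real.sqrt (1 / (4 * d + 1)) - 2 * κ')) * CE *
        Real.sqrt μ := by
    gcongr
  exact add_le_add hB₁ hB₂

section Road

variable {d : ℕ} (L : ℕ) [NeZero L] (m : Fin d → ℕ) [∀ i, NeZero (m i)] (n : ℕ)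
  {𝔸 : Type*} [NormedRing 𝔸] [NormedAlgebra ℂ 𝔸] [CompleteSpace 𝔸]
  {W : Type} [NormedAddCommGroup W] [InnerProductSpace ℂ W] [FiniteDimensional ℂ W] (φ : W ≃ₗ[ℂ] 𝔸) {c₀ : ℝ} [Fact (0 < c₀)]
  (η : ℝ) (U : Bond d (towerP L m (n + 1)) → 𝔸ˣ) {c₁ : ℝ} [Fact (0 < c₁)] (a' : ℝ)
  (hpos' : ∀ x : SiteL2K ℂ d (towerP L m (n + 1)) c₀ W, x ≠ 0 → 0 < RCLike.re ⟪x, laplacePrimeAk L m n φ η U a' (c₁ := c₁) x⟫_ℂ)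
  (η₀ L₀ M₀ R : ℝ) (H : Prop)

/-- **[5] THM 3.1 (3.42) AT HEIGHT `k = n+1` AS `HasMaj S_m S_m (G′_k(U)↾ℝ) (B⋆·e^{−κ′·d_∞})` WITH `B⋆` FREE OF THE HEIGHT** (diagonal `η⁻¹ = L^{n+1}`,
`c₀(L^{n+1})^d = c₁`; `1 ≤ d ≤ k′`; `0 ≤ κ′ ≤ κ`, `2κ′ < 1∕√(4d+1)`; letters (T) `hR`∕`hS`, big-block family `hPS`, (D-P)_k `hP`, (D-E)_k `hdec`):
`B⋆ = (1 + p₂C_E√c₁)·2e^{1∕2}·Σ_{l<k′}2^{l+1} + √(3^d∕c₁·2^{k′})·√(2e^{1∕2}·K_d(1∕√(4d+1) − 2κ′))·C_E·√c₁` — a function of `(d, p₂, C_E, κ′, k′, c₁)` alone.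
[cite: Balaban1985BackgroundPropagators, Thm 3.1 (3.42) p.397, (3.49) p.399, (3.19) p.393] [cite: Balaban1984PropagatorsI, p.36]
[cite: Balaban1985Variational, (180) p.306, (190) p.308] [cite: Balaban1984PropagatorsII, (2.51)–(2.52) p.232] -/
theorem hasMaj_GpOfUk_of_cosh_letters_heightFree_sup (hd : 1 ≤ d)
    (hR : ∀ b w, ‖adTransportW φ U b w‖ ≤ ‖w‖) (hS : ∀ b w, ‖adTransportW φ (fun b => (U b)⁻¹) b w‖ ≤ ‖w‖)
    {PS : TSite d m → SiteL2K ℂ d (towerP L m (n + 1)) c₀ W →L[ℂ] SiteL2K ℂ d (towerP L m (n + 1)) c₀ W}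
    (hPS : ∀ (y : TSite d m) (g : SiteL2K ℂ d (towerP L m (n + 1)) c₀ W) (x : TSite d (towerP L m (n + 1))),
      WL2.equiv ℂ (fun _ : TSite d (towerP L m (n + 1)) => c₀) W (PS y g) x =
        if blockCoord (L ^ (n + 1)) m (siteCast (towerP_eq_fineP_pow L m (n + 1)) x) = y then WL2.equiv ℂ (fun _ : TSite d (towerP L m (n + 1)) => c₀) W g x else 0)
    {p₂ CE κ κ' : ℝ} (hp₂ : 0 ≤ p₂) (hCE : 0 ≤ CE) (hκ' : 0 ≤ κ') (hκ : κ' ≤ κ) (h2κ : 2 * κ' < Real.sqrt (1 / (4 * d + 1)))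
    (hηN : η⁻¹ = (L : ℝ) ^ (n + 1)) (hdiag : c₀ * ((L : ℝ) ^ (n + 1)) ^ d = c₁) {k : ℕ} (hk : d ≤ k)
    (hP : ∀ (v : SiteL2K ℂ d (towerP L m (n + 1)) c₀ W) (x : TSite d (towerP L m (n + 1))),
      ‖WL2.equiv ℂ _ W (laplacePrimeAk L m n φ η U a' (c₁ := c₁) v -
        covLaplaceSiteK ((η : ℂ))⁻¹ (adTransportW φ U) (adTransportW φ fun b => (U b)⁻¹) v) x‖ ≤ p₂ * ‖PS (blockCoord (L ^ (n + 1)) m (siteCast (towerP_eq_fineP_pow L m (n + 1)) x)) v‖)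
    (hdec : ∀ v y : TSite d m, ‖PS y ∘L LinearMap.toContinuousLinearMap (GpOfUk L m n φ η U a' hpos') ∘L PS v‖ ≤
      CE * Real.exp (-(κ * tdist m v y))) :
    HasMaj
      (supSize (toB6 (torusGeom m η₀ L₀ M₀) R H)
        (fun y => Finset.univ.filter fun x : TSite d (towerP L m (n + 1)) => blockCoord (L ^ (n + 1)) m (siteCast (towerP_eq_fineP_pow L m (n + 1)) x) = UT.toSite m y)
        (fun x => UT.ofSite m (blockCoord (L ^ (n + 1)) m (siteCast (towerP_eq_fineP_pow L m (n + 1)) x))) : BlockNorm (toB6 (torusGeom m η₀ L₀ M₀) R H) (TSite d (towerP L m (n + 1)) → W))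
      (supSize (toB6 (torusGeom m η₀ L₀ M₀) R H)
        (fun y => Finset.univ.filter fun x : TSite d (towerP L m (n + 1)) => blockCoord (L ^ (n + 1)) m (siteCast (towerP_eq_fineP_pow L m (n + 1)) x) = UT.toSite m y)
        (fun x => UT.ofSite m (blockCoord (L ^ (n + 1)) m (siteCast (towerP_eq_fineP_pow L m (n + 1)) x))))
      (((WL2.linearEquiv ℂ ℂ (fun _ : TSite d (towerP L m (n + 1)) => c₀) :
            SiteL2K ℂ d (towerP L m (n + 1)) c₀ W ≃ₗ[ℂ] (TSite d (towerP L m (n + 1)) → W)).toLinearMap ∘ₗ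
          GpOfUk L m n φ η U a' (c₁ := c₁) hpos' ∘ₗ
          (WL2.linearEquiv ℂ ℂ (fun _ : TSite d (towerP L m (n + 1)) => c₀) :
            SiteL2K ℂ d (towerP L m (n + 1)) c₀ W ≃ₗ[ℂ] (TSite d (towerP L m (n + 1)) → W)).symm.toLinearMap).restrictScalars ℝ)
      (fun y v => ((1 + p₂ * CE * Real.sqrt c₁) * (Real.exp (1 / 2) * 2) * (∑ l ∈ Finset.range k, (2 : ℝ) ^ (l + 1)) +
          Real.sqrt (3 ^ d / c₁ * 2 ^ k) * Real.sqrt ((Real.exp (1 / 2) * 2) * latticeConst d (Real.sqrt (1 / (4 * d + 1)) - 2 * κ')) *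
            CE * Real.sqrt c₁) *
        Real.exp (-(κ' * tdist m (UT.toSite m y) (UT.toSite m v)))) := by
  have hc₁ : 0 < c₁ := Fact.out
  have hL1 : (1 : ℝ) ≤ L := by exact_mod_cast Nat.one_le_iff_ne_zero.mpr (NeZero.ne L)
  have hN1 : (1 : ℝ) ≤ (L : ℝ) ^ (n + 1) := one_le_pow₀ hL1
  have hN0 : (0 : ℝ) < (L : ℝ) ^ (n + 1) := lt_of_lt_of_le one_pos hN1
  obtain ⟨ha, hlam, hκ₁, hB⟩ := const_heightFree hd hN1 hηN (p₂ := p₂) (CE := CE) (κ' := κ') (μ := c₀ * (((L : ℝ) ^ (n + 1)) ^ d))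
    (c₁ := c₁) hp₂ hCE hc₁ h2κ k
  -- the diagonal letters of the (D-FS) supplier
  have hη : 0 < η⁻¹ := by rw [hηN]; exact hN0
  have hdiag' : c₀ * (η⁻¹) ^ d = c₁ := by rw [hηN]; exact hdiag
  have hvol : ∀ ν, η⁻¹ ≤ (towerP L m (n + 1) ν : ℝ) := fun ν => by
    rw [hηN, towerP_apply]
    push_cast
    have h1 : (1 : ℝ) ≤ (m ν : ℝ) := by exact_mod_cast Nat.one_le_iff_ne_zero.mpr (NeZero.ne (m ν))
    nlinarith
  have h := hasMaj_GpOfUk_of_cosh_letters_sup L m n φ η U a' hpos' η₀ L₀ M₀ R H (c₁ := c₁) hR hS hPS hp₂ hCE ha hlam hk hη hdiag' hvol hκ' hκ hκ₁ hP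
    hdec
  have hμ : Real.sqrt (c₀ * (((L : ℝ) ^ (n + 1)) ^ d)) = Real.sqrt c₁ := by rw [hdiag]
  rw [hμ] at h hB
  exact h.mono fun y v => mul_le_mul_of_nonneg_right hB (Real.exp_nonneg _)

/-- **THE SAME IN THE GEOMETRY's OWN DISTANCE, OPERATOR AS A CONTINUOUS LINEAR MAP** (`δ₀ = κ′∕d`): the `hG` binder of
`Beta.RemainderChartOriginDerivative.ineq190_fderiv_chartH179_zero_of_letters` at height `k = n+1` with the height-free `B⋆`.
[cite: Balaban1985BackgroundPropagators, Thm 3.1 (3.42) p.397] [cite: Balaban1985Variational, (180) p.306, (182) p.307, (190) p.308] [cite: Balaban1984PropagatorsII, (2.51)–(2.52) p.232, (2.54) p.233] -/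
theorem hasMaj_GpOfUk_of_cosh_letters_heightFree (hd : 1 ≤ d)
    (hR : ∀ b w, ‖adTransportW φ U b w‖ ≤ ‖w‖) (hS : ∀ b w, ‖adTransportW φ (fun b => (U b)⁻¹) b w‖ ≤ ‖w‖)
    {PS : TSite d m → SiteL2K ℂ d (towerP L m (n + 1)) c₀ W →L[ℂ] SiteL2K ℂ d (towerP L m (n + 1)) c₀ W}
    (hPS : ∀ (y : TSite d m) (g : SiteL2K ℂ d (towerP L m (n + 1)) c₀ W) (x : TSite d (towerP L m (n + 1))),
      WL2.equiv ℂ (fun _ : TSite d (towerP L m (n + 1)) => c₀) W (PS y g) x =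
        if blockCoord (L ^ (n + 1)) m (siteCast (towerP_eq_fineP_pow L m (n + 1)) x) = y then WL2.equiv ℂ (fun _ : TSite d (towerP L m (n + 1)) => c₀) W g x else 0)
    {p₂ CE κ κ' : ℝ} (hp₂ : 0 ≤ p₂) (hCE : 0 ≤ CE) (hκ' : 0 ≤ κ') (hκ : κ' ≤ κ) (h2κ : 2 * κ' < Real.sqrt (1 / (4 * d + 1)))
    (hηN : η⁻¹ = (L : ℝ) ^ (n + 1)) (hdiag : c₀ * ((L : ℝ) ^ (n + 1)) ^ d = c₁) {k : ℕ} (hk : d ≤ k)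
    (hP : ∀ (v : SiteL2K ℂ d (towerP L m (n + 1)) c₀ W) (x : TSite d (towerP L m (n + 1))),
      ‖WL2.equiv ℂ _ W (laplacePrimeAk L m n φ η U a' (c₁ := c₁) v -
        covLaplaceSiteK ((η : ℂ))⁻¹ (adTransportW φ U) (adTransportW φ fun b => (U b)⁻¹) v) x‖ ≤ p₂ * ‖PS (blockCoord (L ^ (n + 1)) m (siteCast (towerP_eq_fineP_pow L m (n + 1)) x)) v‖)
    (hdec : ∀ v y : TSite d m, ‖PS y ∘L LinearMap.toContinuousLinearMap (GpOfUk L m n φ η U a' hpos') ∘L PS v‖ ≤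
      CE * Real.exp (-(κ * tdist m v y))) :
    HasMaj
      (supSize (toB6 (torusGeom m η₀ L₀ M₀) R H)
        (fun y => Finset.univ.filter fun x : TSite d (towerP L m (n + 1)) => blockCoord (L ^ (n + 1)) m (siteCast (towerP_eq_fineP_pow L m (n + 1)) x) = UT.toSite m y)
        (fun x => UT.ofSite m (blockCoord (L ^ (n + 1)) m (siteCast (towerP_eq_fineP_pow L m (n + 1)) x))) : BlockNorm (toB6 (torusGeom m η₀ L₀ M₀) R H) (TSite d (towerP L m (n + 1)) → W))
      (supSize (toB6 (torusGeom m η₀ L₀ M₀) R H)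
        (fun y => Finset.univ.filter fun x : TSite d (towerP L m (n + 1)) => blockCoord (L ^ (n + 1)) m (siteCast (towerP_eq_fineP_pow L m (n + 1)) x) = UT.toSite m y)
        (fun x => UT.ofSite m (blockCoord (L ^ (n + 1)) m (siteCast (towerP_eq_fineP_pow L m (n + 1)) x))))
      (((LinearMap.toContinuousLinearMap
          ((WL2.linearEquiv ℂ ℂ (fun _ : TSite d (towerP L m (n + 1)) => c₀) :
              SiteL2K ℂ d (towerP L m (n + 1)) c₀ W ≃ₗ[ℂ] (TSite d (towerP L m (n + 1)) → W)).toLinearMap ∘ₗ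
            GpOfUk L m n φ η U a' (c₁ := c₁) hpos' ∘ₗ
            (WL2.linearEquiv ℂ ℂ (fun _ : TSite d (towerP L m (n + 1)) => c₀) :
              SiteL2K ℂ d (towerP L m (n + 1)) c₀ W ≃ₗ[ℂ] (TSite d (towerP L m (n + 1)) → W)).symm.toLinearMap)).restrictScalars ℝ :
          (TSite d (towerP L m (n + 1)) → W) →ₗ[ℝ] (TSite d (towerP L m (n + 1)) → W)))
      (fun y v => ((1 + p₂ * CE * Real.sqrt c₁) * (Real.exp (1 / 2) * 2) * (∑ l ∈ Finset.range k, (2 : ℝ) ^ (l + 1)) +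
          Real.sqrt (3 ^ d / c₁ * 2 ^ k) * Real.sqrt ((Real.exp (1 / 2) * 2) * latticeConst d (Real.sqrt (1 / (4 * d + 1)) - 2 * κ')) *
            CE * Real.sqrt c₁) *
        Real.exp (-(κ' / d * (toB6 (torusGeom m η₀ L₀ M₀) R H).dist y v))) := by
  have hc₁ : 0 < c₁ := Fact.out
  have hL1 : (1 : ℝ) ≤ L := by exact_mod_cast Nat.one_le_iff_ne_zero.mpr (NeZero.ne L)
  have hN1 : (1 : ℝ) ≤ (L : ℝ) ^ (n + 1) := one_le_pow₀ hL1
  have hN0 : (0 : ℝ) < (L : ℝ) ^ (n + 1) := lt_of_lt_of_le one_pos hN1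
  obtain ⟨ha, hlam, hκ₁, hB⟩ := const_heightFree hd hN1 hηN (p₂ := p₂) (CE := CE) (κ' := κ') (μ := c₀ * (((L : ℝ) ^ (n + 1)) ^ d))
    (c₁ := c₁) hp₂ hCE hc₁ h2κ k
  have hη : 0 < η⁻¹ := by rw [hηN]; exact hN0
  have hdiag' : c₀ * (η⁻¹) ^ d = c₁ := by rw [hηN]; exact hdiag
  have hvol : ∀ ν, η⁻¹ ≤ (towerP L m (n + 1) ν : ℝ) := fun ν => by
    rw [hηN, towerP_apply]
    push_cast
    have h1 : (1 : ℝ) ≤ (m ν : ℝ) := by exact_mod_cast Nat.one_le_iff_ne_zero.mpr (NeZero.ne (m ν))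
    nlinarith
  have h := hasMaj_GpOfUk_of_cosh_letters L m n φ η U a' hpos' η₀ L₀ M₀ R H (c₁ := c₁) hR hS hPS hp₂ hCE ha hlam hk hη hdiag' hvol hκ' hκ hκ₁ hP hdec
  have hμ : Real.sqrt (c₀ * (((L : ℝ) ^ (n + 1)) ^ d)) = Real.sqrt c₁ := by rw [hdiag]
  rw [hμ] at h hB
  exact h.mono fun y v => mul_le_mul_of_nonneg_right hB (Real.exp_nonneg _)

end Road

/-! ## (T) inhabited on the chain's class: unitary `U`, `*`-trace, compatible fibre norm -/

section Unitary

variable {d : ℕ} (L : ℕ) [NeZero L] (m : Fin d → ℕ) [∀ i, NeZero (m i)] (n : ℕ)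
  {𝔸 : Type*} [NormedRing 𝔸] [StarRing 𝔸] [NormedAlgebra ℂ 𝔸] [CompleteSpace 𝔸]
  {W : Type} [NormedAddCommGroup W] [InnerProductSpace ℂ W] [FiniteDimensional ℂ W] (φ : W ≃ₗ[ℂ] 𝔸) {c₀ : ℝ} [Fact (0 < c₀)]
  (η : ℝ) (U : Bond d (towerP L m (n + 1)) → 𝔸ˣ) {c₁ : ℝ} [Fact (0 < c₁)] (a' : ℝ)
  (hpos' : ∀ x : SiteL2K ℂ d (towerP L m (n + 1)) c₀ W, x ≠ 0 → 0 < RCLike.re ⟪x, laplacePrimeAk L m n φ η U a' (c₁ := c₁) x⟫_ℂ)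
  (η₀ L₀ M₀ R : ℝ) (H : Prop)

/-- **ON THE CHAIN's CLASS ONLY (D-P)_k AND (D-E)_k REMAIN, WITH THE HEIGHT-FREE `B⋆`**: unitary `U`, a `*`-trace `τ`, compatible fibre norm ⇒ (T) with
equality (`B9Eq342GreenPrimeSupBound.norm_adTransportW_eq`∕`…_inv_eq`). [cite: Balaban1985BackgroundPropagators, Thm 3.1 (3.42) p.397, (3.39) p.397, (3.8) p.392]
[cite: Balaban1985Variational, (180) p.306, (190) p.308] -/
theorem hasMaj_GpOfUk_of_cosh_letters_heightFree_unitary (hd : 1 ≤ d) (τ : 𝔸 →ₗ[ℂ] ℂ) (hτ₂ : ∀ X Y : 𝔸, τ (X * Y) = τ (Y * X))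
    (hU : ∀ b, star (U b : 𝔸) = ((U b)⁻¹ : 𝔸ˣ)) (hφ : ∀ X Y : 𝔸, ⟪φ.symm X, φ.symm Y⟫_ℂ = τ (star X * Y))
    {PS : TSite d m → SiteL2K ℂ d (towerP L m (n + 1)) c₀ W →L[ℂ] SiteL2K ℂ d (towerP L m (n + 1)) c₀ W}
    (hPS : ∀ (y : TSite d m) (g : SiteL2K ℂ d (towerP L m (n + 1)) c₀ W) (x : TSite d (towerP L m (n + 1))),
      WL2.equiv ℂ (fun _ : TSite d (towerP L m (n + 1)) => c₀) W (PS y g) x =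
        if blockCoord (L ^ (n + 1)) m (siteCast (towerP_eq_fineP_pow L m (n + 1)) x) = y then WL2.equiv ℂ (fun _ : TSite d (towerP L m (n + 1)) => c₀) W g x else 0)
    {p₂ CE κ κ' : ℝ} (hp₂ : 0 ≤ p₂) (hCE : 0 ≤ CE) (hκ' : 0 ≤ κ') (hκ : κ' ≤ κ) (h2κ : 2 * κ' < Real.sqrt (1 / (4 * d + 1)))
    (hηN : η⁻¹ = (L : ℝ) ^ (n + 1)) (hdiag : c₀ * ((L : ℝ) ^ (n + 1)) ^ d = c₁) {k : ℕ} (hk : d ≤ k)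
    (hP : ∀ (v : SiteL2K ℂ d (towerP L m (n + 1)) c₀ W) (x : TSite d (towerP L m (n + 1))),
      ‖WL2.equiv ℂ _ W (laplacePrimeAk L m n φ η U a' (c₁ := c₁) v -
        covLaplaceSiteK ((η : ℂ))⁻¹ (adTransportW φ U) (adTransportW φ fun b => (U b)⁻¹) v) x‖ ≤ p₂ * ‖PS (blockCoord (L ^ (n + 1)) m (siteCast (towerP_eq_fineP_pow L m (n + 1)) x)) v‖)
    (hdec : ∀ v y : TSite d m, ‖PS y ∘L LinearMap.toContinuousLinearMap (GpOfUk L m n φ η U a' hpos') ∘L PS v‖ ≤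
      CE * Real.exp (-(κ * tdist m v y))) :
    HasMaj
      (supSize (toB6 (torusGeom m η₀ L₀ M₀) R H)
        (fun y => Finset.univ.filter fun x : TSite d (towerP L m (n + 1)) => blockCoord (L ^ (n + 1)) m (siteCast (towerP_eq_fineP_pow L m (n + 1)) x) = UT.toSite m y)
        (fun x => UT.ofSite m (blockCoord (L ^ (n + 1)) m (siteCast (towerP_eq_fineP_pow L m (n + 1)) x))) : BlockNorm (toB6 (torusGeom m η₀ L₀ M₀) R H) (TSite d (towerP L m (n + 1)) → W))
      (supSize (toB6 (torusGeom m η₀ L₀ M₀) R H)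
        (fun y => Finset.univ.filter fun x : TSite d (towerP L m (n + 1)) => blockCoord (L ^ (n + 1)) m (siteCast (towerP_eq_fineP_pow L m (n + 1)) x) = UT.toSite m y)
        (fun x => UT.ofSite m (blockCoord (L ^ (n + 1)) m (siteCast (towerP_eq_fineP_pow L m (n + 1)) x))))
      (((LinearMap.toContinuousLinearMap
          ((WL2.linearEquiv ℂ ℂ (fun _ : TSite d (towerP L m (n + 1)) => c₀) :
              SiteL2K ℂ d (towerP L m (n + 1)) c₀ W ≃ₗ[ℂ] (TSite d (towerP L m (n + 1)) → W)).toLinearMap ∘ₗ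
            GpOfUk L m n φ η U a' (c₁ := c₁) hpos' ∘ₗ
            (WL2.linearEquiv ℂ ℂ (fun _ : TSite d (towerP L m (n + 1)) => c₀) :
              SiteL2K ℂ d (towerP L m (n + 1)) c₀ W ≃ₗ[ℂ] (TSite d (towerP L m (n + 1)) → W)).symm.toLinearMap)).restrictScalars ℝ :
          (TSite d (towerP L m (n + 1)) → W) →ₗ[ℝ] (TSite d (towerP L m (n + 1)) → W)))
      (fun y v => ((1 + p₂ * CE * Real.sqrt c₁) * (Real.exp (1 / 2) * 2) * (∑ l ∈ Finset.range k, (2 : ℝ) ^ (l + 1)) +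
          Real.sqrt (3 ^ d / c₁ * 2 ^ k) * Real.sqrt ((Real.exp (1 / 2) * 2) * latticeConst d (Real.sqrt (1 / (4 * d + 1)) - 2 * κ')) *
            CE * Real.sqrt c₁) *
        Real.exp (-(κ' / d * (toB6 (torusGeom m η₀ L₀ M₀) R H).dist y v))) :=
  hasMaj_GpOfUk_of_cosh_letters_heightFree L m n φ η U a' hpos' η₀ L₀ M₀ R H (c₁ := c₁) hd
    (fun b w => (norm_adTransportW_eq φ U τ hτ₂ hU hφ b w).le) (fun b w => (norm_adTransportW_inv_eq φ U τ hτ₂ hU hφ b w).le)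
    hPS hp₂ hCE hκ' hκ h2κ hηN hdiag hk hP hdec

end Unitary

end Literature.MathematicalPhysics.QuantumFieldTheory.Balaban1983to89.Beta.RemainderHasMajGreenPrimeTowerDecayCoshHeightFree

end
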